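import Literature.AnabelianGeometry.EtaleTheta.SettingModelTateYCoord
import Literature.AnabelianGeometry.EtaleTheta.SettingModelTateDeltaTheta
import HarnessLib

/-!
# The STAGE-2 (Tate-sheared) χ-model of [EtTh] §1: the `y`-coordinate crossed homomorphism on `(Π^tp_X)^Θ`
# (R78 F6q, theta-quotient level — independent of the `ThetaSetting` record `modelχq`)

Mochizuki, *The étale theta function …*, Publ. RIMS **45** (2009) [EtTh], §1, Prop. 1.5, PRIMS PDF p. 23
[cite: MochizukiEtTh2009, Prop 1.5 p.23]: "`log(U) ∈ H¹(Π^tp_Y, Δ_Θ)`".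

CLASS (b) construction (one small `def` pair `yCoordχq`/`yThetaχq`; abc-iut cell, R78 stage 2, row F6q mapped to
abc-iut-w5-d171 by the integrator abc-iut-L6-d6): the `y`-coordinate `ŷ(g) := ê_b(gfpFst g.left)` on the stage-2
carrier `Π^tp_X = Γ ⋊_{(κ_p^i, κ_p^j, χ)} G_{ℚ_p}` (abc-iut-L2-t6/L2-t5's `PiTpχq p i j`), descended to
`(Π^tp_X)^Θ = CurveTheta.GTheta (curveχq p i j)`, with

* `yCoordχq_mul_of_eHat_eq_one` — the χ-crossed-homomorphism law `ŷ(gh) = ŷ(g)·χ(g)(ŷ(h))` for `h` with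
  `Γ`-component in `Ker ê` (the Tate shear is invisible there: `SettingModelTateYCoord`), in particular on `Π^tp_Y`;
* `yThetaχq`, `yThetaχq_toTheta`, `continuous_yThetaχq`, `yThetaχq_mul` (the law on `(Π^tp_X)^Θ` for `h` in the image
  of `Ker ê`-elements), `yThetaχq_inl_bPowGfp` (`ŷ(b^t) = t`), `yCoordχq_mem_range_sqHom` (evenness from the
  level-`2` `y`-coordinate);

so that `KummerData(modelχq)` (F6q proper) is `ThetaSetting.YCoordKit` (`KummerDataYCoord`) instantiated with
abc-iut-L6-d6's `deltaThetaCoordχq` the minute abc-iut-L2-t5's record `modelχq` lands.  Semi-synthetic; nothing of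
[EtTh] asserted; no side taken on [IUTchIII] Cor. 3.12.
-/

noncomputable section

open Topology

namespace Literature.AnabelianGeometry.EtaleTheta.SettingModel

open Literature.AnabelianGeometry.SemiGraphs

variable (p : ℕ) [Fact p.Prime] (i j : ℤ)

/-- `ŷ(g) := ê_b(gfpFst g.left)` on the stage-2 carrier. [cite: MochizukiEtTh2009, Prop 1.5 p.23] -/
def yCoordχq (g : PiTpχq p i j) : ZH := eHatB (gfpFst g.left)

/-- [cite: MochizukiEtTh2009, Prop 1.5 p.23] -/
theorem yCoordχq_apply (g : PiTpχq p i j) : yCoordχq p i j g = eHatB (gfpFst g.left) := rfl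

/-- **`ŷ(gh) = ŷ(g)·χ(g)(ŷ(h))` whenever `h`'s `Γ`-component lies in `Ker ê`** (e.g. `h ∈ Π^tp_Y`): the Tate shear
does not move the `b`-exponent on `Ker ê`. [cite: MochizukiEtTh2009, Prop 1.5 p.23] -/
theorem yCoordχq_mul_of_eHat_eq_one (g h : PiTpχq p i j) (hh : eHat (gfpFst h.left) = 1) :
    yCoordχq p i j (g * h) = yCoordχq p i j g * chi p g.right (yCoordχq p i j h) := by
  unfold yCoordχq
  rw [SemidirectProduct.mul_left, map_mul, map_mul, gfpFst_actχq, eHatB_actHatχq_of_eHat_eq_one p i j _ hh]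
  rfl

/-- `ŷ` is continuous. [cite: MochizukiEtTh2009, Prop 1.5 p.23] -/
theorem continuous_yCoordχq : Continuous (yCoordχq p i j) :=
  eHatB.continuous.comp (gfpFst.continuous.comp (Semidirect.continuous_left (isInducing_leftRightχq p i j)))

/-- If all Heisenberg levels of `x ∈ F̂₂` vanish then `ê(x) = 0` and `ê_b(x) = 0`. [cite: MochizukiEtTh2009, §1 p.12] -/
theorem eHat_eq_one_and_eHatB_eq_one_of_forall_hHat {x : F₂hatT} (hx : ∀ N : ℕ+, hHat N x = 1) :
    eHat x = 1 ∧ eHatB x = 1 := by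
  refine ⟨ext_of_modN fun N => ?_, ext_of_modN fun N => ?_⟩
  · rw [map_one, ← hHat_x_eq_modN_eHat, hx N]
    rfl
  · rw [map_one, ← hHat_y_eq_modN_eHatB, hx N]
    rfl

/-- `ŷ` kills `Ker(Π^tp_X ↠ (Π^tp_X)^Θ)`. [cite: MochizukiEtTh2009, Prop 1.5 p.23] -/
theorem yCoordχq_eq_one_of_mem_thetaKer {g : PiTpχq p i j} (hg : g ∈ CurveTheta.thetaKer (curveχq p i j)) :
    yCoordχq p i j g = 1 :=
  (eHat_eq_one_and_eHatB_eq_one_of_forall_hHat ((mem_thetaKerχq_iff p i j g).mp hg).1).2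

/-- `ŷ` descended to `(Π^tp_X)^Θ`. [cite: MochizukiEtTh2009, Prop 1.5 p.23] -/
def yThetaχq : CurveTheta.GTheta (curveχq p i j) → ZH :=
  Quotient.lift (yCoordχq p i j) fun a b hab => by
    have hab' : a⁻¹ * b ∈ CurveTheta.thetaKer (curveχq p i j) := QuotientGroup.leftRel_apply.mp hab
    have hk : eHat (gfpFst (a⁻¹ * b).left) = 1 :=
      (eHat_eq_one_and_eHatB_eq_one_of_forall_hHat ((mem_thetaKerχq_iff p i j _).mp hab').1).1
    have hb : b = a * (a⁻¹ * b) := by group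
    have := yCoordχq_mul_of_eHat_eq_one p i j a (a⁻¹ * b) hk
    rw [← hb, yCoordχq_eq_one_of_mem_thetaKer p i j hab', map_one, mul_one] at this
    exact this.symm

/-- [cite: MochizukiEtTh2009, Prop 1.5 p.23] -/
@[simp] theorem yThetaχq_toTheta (g : PiTpχq p i j) :
    yThetaχq p i j (CurveTheta.toTheta (curveχq p i j) g) = yCoordχq p i j g := rfl

/-- `ŷ` on `(Π^tp_X)^Θ` is continuous. [cite: MochizukiEtTh2009, Prop 1.5 p.23] -/
theorem continuous_yThetaχq : Continuous (yThetaχq p i j) :=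
  (QuotientGroup.isQuotientMap_mk (CurveTheta.thetaKer (curveχq p i j))).continuous_iff.mpr
    (continuous_yCoordχq p i j)

/-- **The crossed-homomorphism law on `(Π^tp_X)^Θ`** for second factors represented in `Ker ê`:
`ŷ(x·[h]) = ŷ(x)·χ(aug^Θ x)(ŷ[h])`. [cite: MochizukiEtTh2009, Prop 1.5 p.23] -/
theorem yThetaχq_mul (x : CurveTheta.GTheta (curveχq p i j)) (h : PiTpχq p i j) (hh : eHat (gfpFst h.left) = 1) :
    yThetaχq p i j (x * CurveTheta.toTheta (curveχq p i j) h) =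
      yThetaχq p i j x * chi p (CurveTheta.augTheta (curveχq p i j) x) (yThetaχq p i j (CurveTheta.toTheta _ h)) := by
  obtain ⟨g, rfl⟩ := CurveTheta.toTheta_surjective (curveχq p i j) x
  rw [← map_mul, yThetaχq_toTheta, yThetaχq_toTheta, yThetaχq_toTheta, CurveTheta.augTheta_toTheta,
    yCoordχq_mul_of_eHat_eq_one p i j g h hh]
  rfl

/-- `Γ`-components in `Ker(Γ ↠ ℤ)` lie in `Ker ê`. [cite: MochizukiEtTh2009, §1 p.13] -/
theorem eHat_gfpFst_left_eq_one {g : PiTpχq p i j} (hg : gfpSnd g.left = 1) : eHat (gfpFst g.left) = 1 :=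
  eHat_gfpFst_eq_one_of_gfpSnd hg

/-- Evenness from the level-`2` `y`-coordinate: `(ĥ₂ γ).y = 0 ⇒ ŷ ∈ 2Ẑ`. [cite: MochizukiEtTh2009, Prop 1.5 p.23] -/
theorem yCoordχq_mem_range_sqHom {g : PiTpχq p i j} (hg : (hHat 2 (gfpFst g.left)).y = 0) :
    yCoordχq p i j g ∈ sqHom.range := by
  rw [mem_range_sqHom_iff]
  exact (hHat_y_eq_zero_iff 2 (gfpFst g.left)).mp hg

/-- `ŷ((b^t, 0) ⋊ 1) = t`. [cite: MochizukiEtTh2009, Prop 1.5 p.23] -/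
theorem yCoordχq_inl_bPowGfp (t : ZH) : yCoordχq p i j (SemidirectProduct.inl (bPowGfp t)) = t := by
  show eHatB (gfpFst (SemidirectProduct.inl (bPowGfp t) : PiTpχq p i j).left) = t
  rw [SemidirectProduct.left_inl]
  exact eHatB_bPow t

/-- The `log(U)`-cocycle values `c^{ŷ}` composed with abc-iut-L6-d6's stage-2 coordinates are χ-compatible:
`c^{χ(aug^Θ g)·t} = g c^t g⁻¹` (re-export of `deltaThetaCoordχq_chi` in `YCoordKit` shape).
[cite: MochizukiEtTh2009, Prop 1.5 p.23] -/
theorem iota_chiT_curveχq (g : CurveTheta.GTheta (curveχq p i j)) (t : ZH) :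
    deltaThetaCoordχq p i j (((chi p).comp (CurveTheta.augTheta (curveχq p i j))) g t) =
      MulAut.conjNormal g (deltaThetaCoordχq p i j t) :=
  deltaThetaCoordχq_chi p i j g t

end Literature.AnabelianGeometry.EtaleTheta.SettingModel

end
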